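import Summits.ResolutionOfSingularities.ResolutionOfSingularities.Theorems.FrobeniusClosingPatchingRelPerfectConeDepthTwoCharts
import Summits.ResolutionOfSingularities.ResolutionOfSingularities.Theorems.FrobeniusClosingPatchingRelPerfectChartStrictExceptional
import Summits.ResolutionOfSingularities.ResolutionOfSingularities.Theorems.FrobeniusClosingPatchingRelPerfectConeMemberLevelTwo
import HarnessLib

/-!
# Crux `PatchingRelPerfect` (stmt-ResolutionOfSingularities-16161), chain w52 — R4ˢ INSTANCE:
# the quadric-CONE member at exceptional depth two — LEVEL TWO (the vertex blow-up), regularity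

[OURS · L1 W5.2 · rung] Regularity half, level two, of the depth-two cone member
`I = (x₀x₁ + x₂²) + 𝔪⁴` (identities: `…ConeDepthTwoCharts.lean`; rung and level one:
`…ConeDepthTwo.lean`).  Abstract setting as in r2pt part 2c (`…ConeMemberLevelTwo.lean`): `A` a
regular domain, `c = (t, v₀, v₁, v₂)` quasi-regular with `A/(c)` a regular domain, `A/(t)` a
domain, `v_k ∉ (t)`, `F = v₀v₁ + v₂² ∉ (t)`, and the cone `V(t, F)` regular off its vertex.  On the
`v_k`-chart `C_j` of `Bl_{(c)}` (exceptional parameter `w`, `u' = e'₀` the strict transform of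
`E = V(t)`, `G = e'₁e'₂ + e'₃²` the strict transform of the cone) the residual factors are
`(L K) C_j = w⁴ · (u', G) · ((G) + (u'²))`, and we PROVE:

* `isWeaklyRegular_w_u'_G` — `(w, u', G)` is a weakly regular sequence (chart family + conic);
* `isRegularRing_quot_span_u'_G` — **the strict transform `V(u', G)` of the cone surface is a
  REGULAR centre** (prime by prime: on `V(w)` by the regular sequence, off `V(w)` by transport from
  `A/(t, F)` through `C_j[1/w] = A[1/v_k]`; toolkit `…QuotientRegularityTools.lean`);
* `isRegular_of_isBlowup_LK_succ` — every blow-up of `Spec C_j` along `(L K) C_j` is regular: the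
  two-step Euclidean tower of stub-1's `isRegular_of_isBlowup_tower` along the pair `(u', G)`,
  quasi-regular by `…ChartStrictExceptional.lean` (this is plan-1's «order-one residual finishes by
  local maximal contact», kernel note 2026-08-27T04:50:53Z, at `ℓ = 2`);
* `isRegular_of_isBlowup_LK_zero` (the `t`-chart: Cartier) and the level-two assembly
  `isRegular_of_isBlowup_LK_mul_span` — **every blowing up of `Spec A` along
  `(L K) · (t, v₀, v₁, v₂)` is regular**.

FORMAT evidence for the core only; nothing here is a statement of the manuscript under review.

## References

* The Stacks Project, Tags 080A, 080B, 0804, 07Z3, 0BIQ. [StacksProject]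
* Q. Liu, *Algebraic Geometry and Arithmetic Curves*, OUP 2002, Thm. 8.1.19 (a). [Liu2002]
* H. Matsumura, *Commutative Ring Theory*, CUP 1986, Thms. 14.2, 16.2, 16.3. [Matsumura1987]
-/

-- `Summit.<Summit>.<Sub>.Theorems` with `Sub = Summit` (single-conjunct summit, D-0017)
set_option linter.dupNamespace false

noncomputable section

open CategoryTheory CategoryTheory.Limits AlgebraicGeometry Literature.AlgebraicGeometry.Resolution
open IsLocalRing

namespace Summit.ResolutionOfSingularities.ResolutionOfSingularities.Theorems

namespace ConeRung

universe u

/-! ## Level two over a regular base: the strict transform of the cone is a regular centre -/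

section LevelTwoRegular

variable {A : Type u} [CommRing A] (t : A) (v : Fin 3 → A)
  (hc : IsQuasiRegular (Fin.cons t v : Fin 4 → A))

local notation3 "cc" => (Fin.cons t v : Fin 4 → A)
local notation3 "F" => v 0 * v 1 + v 2 ^ 2
local notation3 "LL" => Ideal.span {v 0 * v 1 + v 2 ^ 2} ⊔
  Ideal.span {t} * Ideal.span {t, v 0, v 1, v 2}
local notation3 "KK" => Ideal.span {v 0 * v 1 + v 2 ^ 2} ⊔ Ideal.span {t} ^ 2
/-- the `v_k`-chart (`j = k + 1`) and its data -/
local notation3 "w[" k "]" => chartBase cc (Fin.succ k) (cc (Fin.succ k))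
local notation3 "u'[" k "]" => chartGen cc (Fin.succ k) 0
local notation3 "G[" k "]" => chartGen cc (Fin.succ k) 1 * chartGen cc (Fin.succ k) 2 +
  chartGen cc (Fin.succ k) 3 ^ 2
/-- the plane family `(w, u')` and the pair `(u', G)` -/
local notation3 "c₃[" k "]" => (Fin.cons (chartBase cc (Fin.succ k) (cc (Fin.succ k)))
  (fun _ : Fin 1 => chartGen cc (Fin.succ k) 0) : Fin 2 → chartRing cc (Fin.succ k))
local notation3 "x'[" k "]" => (Fin.cons (chartGen cc (Fin.succ k) 0)
  (fun _ : Fin 1 => chartGen cc (Fin.succ k) 1 * chartGen cc (Fin.succ k) 2 +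
    chartGen cc (Fin.succ k) 3 ^ 2) : Fin 2 → chartRing cc (Fin.succ k))

/-- `Ideal.ofList [w, u'] = (c₃)`. [folklore] -/
theorem ofList_w_u'_eq (k : Fin 3) :
    Ideal.ofList [w[k], u'[k]] = Ideal.span (Set.range c₃[k]) := by
  rw [Ideal.ofList_cons, Ideal.ofList_singleton, span_range_cthree, Ideal.span_insert]

/-- `Ideal.ofList [w, u', G] = (c₃) + (G)`. [folklore] -/
theorem ofList_w_u'_G_eq (k : Fin 3) :
    Ideal.ofList [w[k], u'[k], G[k]] = Ideal.span (Set.range c₃[k]) ⊔ Ideal.span {G[k]} := by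
  rw [Ideal.ofList_cons, Ideal.ofList_cons, Ideal.ofList_singleton, span_range_cthree,
    Ideal.span_insert, sup_assoc]

/-- `(x') = (u', G)`. [folklore] -/
theorem span_range_x'_eq (k : Fin 3) :
    Ideal.span (Set.range x'[k]) = Ideal.span {u'[k], G[k]} := by
  rw [Fin.range_cons u'[k] (fun _ : Fin 1 => G[k]), Set.range_const]

include hc in
/-- **`(w, u', G)` is a weakly regular sequence on the `v_k`-chart** (`(w, u')` is a chart
family and `G` is a non-zero-divisor modulo it). [cite: StacksProject, Tag 0BIQ] -/
theorem isWeaklyRegular_w_u'_G (k : Fin 3) [IsDomain (A ⧸ Ideal.span (Set.range cc))] :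
    RingTheory.Sequence.IsWeaklyRegular (chartRing cc (Fin.succ k)) [w[k], u'[k], G[k]] := by
  have h12 : RingTheory.Sequence.IsWeaklyRegular (chartRing cc (Fin.succ k)) [w[k], u'[k]] := by
    have h := CoreRungTower.isWeaklyRegular_chartFamily cc (Fin.succ k)
      (fun _ : Fin 1 => (⟨0, (Fin.succ_ne_zero k).symm⟩ : {l : Fin 4 // l ≠ Fin.succ k})) hc
      (Function.injective_of_subsingleton _)
    simpa [List.ofFn_succ] using h
  rw [show [w[k], u'[k], G[k]] = [w[k], u'[k]] ++ [G[k]] from rfl,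
    RingTheory.Sequence.isWeaklyRegular_append_iff]
  refine ⟨h12, ?_⟩
  rw [RingTheory.Sequence.isWeaklyRegular_singleton_iff]
  have hsm := isSMulRegular_quotient_of_mem_nonZeroDivisors (Ideal.span (Set.range c₃[k])) G[k]
    (mk_G_mem_nonZeroDivisors t v hc k)
  have hK : (Ideal.ofList [w[k], u'[k]] • ⊤ :
      Submodule (chartRing cc (Fin.succ k)) (chartRing cc (Fin.succ k))) =
      Ideal.span (Set.range c₃[k]) := by
    rw [smul_eq_mul, Ideal.mul_top, ofList_w_u'_eq]
  exact ((Submodule.quotEquivOfEq _ _ hK).isSMulRegular_congr _).mpr hsm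

include hc in
/-- `C_j ⧸ (w, u', G)` is a regular ring (the conic). [cite: Matsumura1987, Thm. 14.2] -/
theorem isRegularRing_quot_w_u'_G (k : Fin 3) [IsDomain (A ⧸ Ideal.span (Set.range cc))]
    [IsRegularRing (A ⧸ Ideal.span (Set.range cc))] :
    IsRegularRing (chartRing cc (Fin.succ k) ⧸ Ideal.ofList [w[k], u'[k], G[k]]) := by
  haveI := isRegularRing_quot_cthree_sup_G t v hc k
  exact IsRegularRing.of_ringEquiv (Ideal.quotEquivOfEq (ofList_w_u'_G_eq t v k)).symm

include hc in
/-- **The strict transform `V(u', G)` of the cone surface is a regular centre on the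
`v_k`-chart**: at primes containing `w` by the regular sequence `(w, u', G)` with regular quotient
(toolkit `isRegularLocalRing_localization_quotient_of_isWeaklyRegular_cons`), at primes not
containing `w` by transport from `A ⧸ (t, F)` through `C_j[1/w] = A[1/v_k]`
(`isRegularLocalRing_quot_span_u'_G`). [cite: Matsumura1987, Thm. 16.3] [cite: StacksProject, Tag 07Z3] -/
theorem isRegularRing_quot_span_u'_G (k : Fin 3) [IsRegularRing A]
    [IsDomain (A ⧸ Ideal.span (Set.range cc))] [IsRegularRing (A ⧸ Ideal.span (Set.range cc))]
    (hreg1 : ∀ (P : Ideal (A ⧸ Ideal.span {t, F})) [P.IsPrime],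
      Ideal.Quotient.mk (Ideal.span {t, F}) (v k) ∉ P → IsRegularLocalRing (Localization.AtPrime P)) :
    IsRegularRing (chartRing cc (Fin.succ k) ⧸ Ideal.span {u'[k], G[k]}) := by
  haveI : IsRegularRing (chartRing cc (Fin.succ k)) := isRegularRing_blowupChart cc (Fin.succ k) hc
  haveI : IsNoetherianRing (chartRing cc (Fin.succ k) ⧸ Ideal.span {u'[k], G[k]}) :=
    Ideal.Quotient.isNoetherianRing _
  have hofList : Ideal.ofList [u'[k], G[k]] = Ideal.span {u'[k], G[k]} := by
    rw [Ideal.ofList_cons, Ideal.ofList_singleton, ← Ideal.span_insert]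
  rw [isRegularRing_iff]
  intro Qbar hQbar
  by_cases hw : Ideal.Quotient.mk (Ideal.span {u'[k], G[k]}) w[k] ∈ Qbar
  · haveI := isRegularRing_quot_w_u'_G t v hc k
    let e := Ideal.quotEquivOfEq (R := chartRing cc (Fin.succ k)) hofList
    set Qbar' : Ideal (chartRing cc (Fin.succ k) ⧸ Ideal.ofList [u'[k], G[k]]) := Qbar.comap e
      with hQbar'
    have hw' : Ideal.Quotient.mk (Ideal.ofList [u'[k], G[k]]) w[k] ∈ Qbar' := by
      rw [hQbar', Ideal.mem_comap]
      change e (Ideal.Quotient.mk _ w[k]) ∈ Qbar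
      rwa [Ideal.quotEquivOfEq_mk]
    haveI := isRegularLocalRing_localization_quotient_of_isWeaklyRegular_cons w[k] [u'[k], G[k]]
      (isWeaklyRegular_w_u'_G t v hc k) Qbar' hw'
    exact isRegularLocalRing_localization_of_ringEquiv e Qbar
  · exact isRegularLocalRing_quot_span_u'_G t v k hreg1 Qbar hw

include hc in
/-- **The `v_k`-chart of `Bl_{z₀}`: every blow-up of `Spec C_j` along
`(L K) C_j = w⁴ · (u', G) · ((G) + (u'²))` is regular** — twist off `w⁴` (Stacks 080B) and run the
two-step Euclidean tower of `isRegular_of_isBlowup_tower` along the quasi-regular pair `(u', G)`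
(`strictExc_isQuasiRegular_pair`) whose quotient is regular (`isRegularRing_quot_span_u'_G`).
[cite: Liu2002, Thm. 8.1.19 (a)] [cite: StacksProject, Tag 080A] -/
theorem isRegular_of_isBlowup_LK_succ (k : Fin 3) [IsRegularRing A] [IsDomain A]
    [IsDomain (A ⧸ Ideal.span (Set.range cc))] [IsRegularRing (A ⧸ Ideal.span (Set.range cc))]
    [IsDomain (A ⧸ Ideal.span {t})] (hvk : v k ∉ Ideal.span {t}) (hFt : F ∉ Ideal.span {t})
    (hreg1 : ∀ (P : Ideal (A ⧸ Ideal.span {t, F})) [P.IsPrime],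
      Ideal.Quotient.mk (Ideal.span {t, F}) (v k) ∉ P → IsRegularLocalRing (Localization.AtPrime P))
    {Y : Scheme.{u}} {ρ : Y ⟶ Spec (.of (chartRing cc (Fin.succ k)))}
    (hρ : IsBlowup ρ (affineBlowup.idealSheaf ((LL * KK).map (chartBase cc (Fin.succ k))))) :
    Scheme.IsRegular Y := by
  haveI : IsRegularRing (chartRing cc (Fin.succ k)) := isRegularRing_blowupChart cc (Fin.succ k) hc
  have hx' : IsQuasiRegular x'[k] :=
    strictExc_isQuasiRegular_pair t v k hc hvk (chartBase_F_two t v (Fin.succ k)) hFt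
  have hR' : IsRegularRing (chartRing cc (Fin.succ k) ⧸ Ideal.span (Set.range x'[k])) := by
    rw [span_range_x'_eq]
    exact isRegularRing_quot_span_u'_G t v hc k hreg1
  have hw4 : w[k] ^ 4 ∈ nonZeroDivisors (chartRing cc (Fin.succ k)) :=
    pow_mem (reesChartBase_mem_nonZeroDivisors (cc (Fin.succ k))
      (Ideal.mem_span_range_self (f := cc) (x := Fin.succ k))) 4
  rw [map_chartBase_LK_succ] at hρ
  exact CoreRungTower.isRegular_of_isBlowup_span_singleton_mul hw4 _
    (fun Y' ρ' h' => isRegular_of_isBlowup_tower 2 x'[k] (fun _ : Fin 1 => (1 : Fin 2))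
      (Function.injective_of_subsingleton _) hx' hR' h') hρ

include hc in
/-- **The `t`-chart of `Bl_{z₀}`: every blow-up of `Spec C₀` along `(L K) C₀ = (w⁴)` is regular**
(an isomorphism onto the regular chart). [cite: Liu2002, Thm. 8.1.19 (a) (affine charts)] -/
theorem isRegular_of_isBlowup_LK_zero [IsRegularRing A]
    [IsRegularRing (A ⧸ Ideal.span (Set.range cc))]
    {Y : Scheme.{u}} {ρ : Y ⟶ Spec (.of (chartRing cc 0))}
    (hρ : IsBlowup ρ (affineBlowup.idealSheaf ((LL * KK).map (chartBase cc 0)))) :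
    Scheme.IsRegular Y := by
  haveI : IsRegularRing (chartRing cc 0) := isRegularRing_blowupChart cc 0 hc
  rw [map_chartBase_LK_zero] at hρ
  exact isRegular_of_isBlowup_idealSheaf_span_singleton_of_isRegularRing
    (pow_mem (reesChartBase_mem_nonZeroDivisors (cc 0)
      (Ideal.mem_span_range_self (f := cc) (x := 0))) 4) hρ

include hc in
/-- **LEVEL TWO: every blowing up of `Spec A` along `(L K) · (t, v₀, v₁, v₂)` is regular** —
blow up the vertex `(t, v)` (chartwise assembly, Stacks 080A) and use the chart statements.
[cite: StacksProject, Tag 080A] [cite: Liu2002, Thm. 8.1.19 (a)] -/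
theorem isRegular_of_isBlowup_LK_mul_span [IsRegularRing A] [IsDomain A]
    [IsDomain (A ⧸ Ideal.span (Set.range cc))] [IsRegularRing (A ⧸ Ideal.span (Set.range cc))]
    [IsDomain (A ⧸ Ideal.span {t})] (hv : ∀ k, v k ∉ Ideal.span {t}) (hFt : F ∉ Ideal.span {t})
    (hreg1 : ∀ (k : Fin 3) (P : Ideal (A ⧸ Ideal.span {t, F})) [P.IsPrime],
      Ideal.Quotient.mk (Ideal.span {t, F}) (v k) ∉ P → IsRegularLocalRing (Localization.AtPrime P))
    {Y : Scheme.{u}} {f : Y ⟶ Spec (.of A)}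
    (hf : IsBlowup f (affineBlowup.idealSheaf ((LL * KK) * Ideal.span {t, v 0, v 1, v 2}))) :
    Scheme.IsRegular Y := by
  nth_rw 2 [span_t_v_eq t v] at hf
  exact isRegular_of_isBlowup_mul_of_charts cc _
    (fun j => Fin.cases
      (motive := fun j => ∀ (Y : Scheme.{u}) (ρ : Y ⟶ Spec (.of (chartRing cc j))),
        IsBlowup ρ (affineBlowup.idealSheaf ((LL * KK).map (chartBase cc j))) →
          Scheme.IsRegular Y)
      (fun _ _ h => isRegular_of_isBlowup_LK_zero t v hc h)
      (fun k _ _ h => isRegular_of_isBlowup_LK_succ t v hc k (hv k) hFt (hreg1 k) h) j) hf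

end LevelTwoRegular

end ConeRung

end Summit.ResolutionOfSingularities.ResolutionOfSingularities.Theorems

end
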